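import Summits.HodgeConjecture.CorCM.IrreducibleOddWeightsIndexHelly
import Summits.HodgeConjecture.CorCM.IrreducibleOddWeightsCertificateCMFields
import HarnessLib

/-!
# `Hg(∏ A_i) = ∏ Hg(A_i)` is decided on sub-products of at most `t + 1` factors, `t` the index of an abelian subgroup
# of `Gal(L/ℚ)` — CM fields inside a Galois field `L`, no representation listed

COR-CM (cell `pub-hodgecm2`, binder seat `b16` gen 59, count-neutral claim INDEX BOUND, file F4 — CM fields; theorems
only, no definition, no named fact, no `sorry`).  NEW as stated, hence under `Summits/`.  HONEST FRAMING: «rank /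
nondegeneracy / Hodge conjecture with `B• = D•` for NAMED configurations of CM abelian varieties» (kernel, unconditional)
for INT-4 «what is known»; `HC_CM` is neither used nor asserted.

SETTING.  CM fields `K_i` (`i ∈ I` finite) with ring embeddings `e_i : K_i → L` into ONE number field `L` GALOIS over
`ℚ` (e.g. the Galois closure of the compositum), `ι : L → ℂ`; CM types `Φ_i` of the `K_i`; `A_i` abelian varieties of
CM type `(K_i, Φ_i)`.  «Nondegenerate family» = `CMAlgebra.IsNondegenerateFamily Φ` = `dim Hg(∏_i A_i) = Σ_i dim A_i`
(`Hg(∏ A_i) = ∏ Hg(A_i)`, each of maximal rank) ⟹ `B• = D•` and the Hodge conjecture on every product of the `A_i`.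

* **`isNondegenerateFamily_iff_forall_card_le_index_succ`** — THE HELLY NUMBER IS AT MOST THE INDEX OF AN ABELIAN
  SUBGROUP: for every subgroup `A ≤ Gal(L/ℚ)` with pairwise commuting elements, the family `(Φ_i)_{i∈I}` is
  nondegenerate IFF every non-empty sub-family of at most `[Gal(L/ℚ) : A] + 1` members is.  No representation, no
  certificate, no character is listed: `Aut(ℂ)` acts on every `Hom(K_i, ℂ)` through `Gal(L/ℚ)`, the preimage of `A`
  acts through commuting permutations, and F3 `…IndexHelly` applies.
* **`exists_card_le_index_succ_not_isNondegenerateFamily`** — a degenerate family has a degenerate sub-family of at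
  most `[Gal(L/ℚ) : A] + 1` members (exceptional Hodge classes on `∏ A_i` are explained by a sub-product of that size
  OR by a degenerate member).
* **`isNondegenerateFamily_iff_forall_card_le_index_zpowers_succ`** — for ANY `g ∈ Gal(L/ℚ)`: sub-families of at most
  `[Gal(L/ℚ) : ⟨g⟩] + 1` members decide (an element of order `|Gal|/2` ⟹ TRIPLES).
* **`isNondegenerateFamily_iff_forall_card_le_two_of_comm`** — `Gal(L/ℚ)` abelian: PAIRS decide, for arbitrary CM
  subfields `K_i ⊆ L` (the tree's `AbelianCMFieldsHodge` / `AbelianCMFamilyRankCharacters` criterion, recovered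
  without characters).
* **`hodgeConjectureFor_prod_of_forall_card_le_index_succ`** — if every sub-family of `≤ [Gal(L/ℚ):A] + 1` members is
  nondegenerate, the Hodge conjecture holds with `B• = D•` on every product `∏_j A_{c(j)}` of realisations.

EXAMPLES (by the least index `t` of an abelian subgroup of `Gal(L/ℚ)`): `t = 1` — `L` abelian (cyclotomic, …):
PAIRS; `t = 2` — `Gal(L/ℚ)` dihedral `D_n`, dicyclic / generalised quaternion, semidihedral, modular, any `C ⋊ C₂` with
`C` abelian: TRIPLES (and pairs do NOT suffice in general — gen 55: the `SD₁₆` octics have all pairs additive and no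
additive triple); `Gal(L/ℚ) ≅ SL₂(𝔽₃)` (`C₆` of index 4): 5-fold sub-products; `S₄` (`V₄`, index 6) or `GL₂(𝔽₃)` (a Singer
cycle `C₈`, index 6): 7-fold sub-products.

## References

* [Serre1977] J.-P. Serre, *Linear Representations of Finite Groups*, GTM 42 (1977), §3.1 Cor. to Thm. 9, §12.2.
* [Mai1989] L. Mai, *Lower bounds for the ranks of CM types*, J. Number Theory 32 (1989), §2 Prop. 1.
* [Gordon1999HodgeAVSurvey] B. B. Gordon, *A survey of the Hodge conjecture for abelian varieties*, 7.5–7.7, 10.10.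
* [Shimura1998] G. Shimura, *Abelian Varieties with Complex Multiplication and Modular Functions*, §8.1.
* [Kubota1965] T. Kubota, *On the field extension by complex multiplication*, Trans. AMS 118 (1965), §4 Lemma 2.
-/

set_option autoImplicit false

noncomputable section

open scoped BigOperators

open CategoryTheory CategoryTheory.Limits NumberField

namespace Summit.HodgeConjecture.CorCM

open Literature.NumberTheory.ComplexMultiplication
open Literature.AlgebraicGeometry.Motives (AbelianVariety CMType)
open Literature.AlgebraicGeometry.HodgeTheory
open Literature.AlgebraicGeometry.ComplexMultiplication (IsCMTypeRealisation)
open Literature.AlgebraicGeometry.Pohlmann1968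
open Literature.AlgebraicGeometry.VanGeemen1994 (hodgeClassSpan)
open Literature.Barriers.HodgeConjecture (divisorClassesSpan)

variable {I : Type} [Fintype I] {K : I → Type} [∀ i, Field (K i)] [∀ i, NumberField (K i)] [∀ i, IsCMField (K i)]
  {L : Type} [Field L] [NumberField L] [Normal ℚ L]

/-! ### §1 `Aut(ℂ)` acts on `Hom(K_i, ℂ)` through `Gal(L/ℚ)`: commuting Galois elements give commuting permutations -/

omit [Fintype I] [∀ i, IsCMField (K i)] in
/-- **The preimage in `Aut(ℂ)` of a subgroup `A ≤ Gal(L/ℚ)` with pairwise commuting elements acts on every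
`Hom(K_i, ℂ)` through pairwise commuting permutations** (`τ ∘ (ι ∘ g ∘ e_i) = ι ∘ (r(τ) g) ∘ e_i` and every embedding
is an `ι ∘ g ∘ e_i`, `L` normal). [cite: Shimura1998, §8.1] -/
theorem smul_comm_of_comap_restrictHom (ι : L →+* ℂ) (e : ∀ i, K i →+* L) {r : (ℂ ≃+* ℂ) →* (L ≃ₐ[ℚ] L)}
    (hr : ∀ (τ : ℂ ≃+* ℂ) (y : L), τ (ι y) = ι (r τ y)) (A : Subgroup (L ≃ₐ[ℚ] L))
    (hA : ∀ a ∈ A, ∀ b ∈ A, a * b = b * a) :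
    ∀ τ ∈ A.comap r, ∀ τ' ∈ A.comap r, ∀ (i : I) (s : K i →+* ℂ), τ • τ' • s = τ' • τ • s := by
  intro τ hτ τ' hτ' i s
  obtain ⟨g, rfl⟩ := exists_eq_comp_algEquiv_comp ι e i s
  have hsm : ∀ (τ : ℂ ≃+* ℂ) (g : L ≃ₐ[ℚ] L),
      τ • (ι.comp (g : L →+* L)).comp (e i) = (ι.comp ((r τ * g : L ≃ₐ[ℚ] L) : L →+* L)).comp (e i) := fun τ g => by
    refine RingHom.ext fun x => ?_
    change τ (ι (g (e i x))) = ι ((r τ * g) (e i x))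
    rw [hr, AlgEquiv.mul_apply]
  rw [hsm, hsm, hsm, hsm, ← mul_assoc, ← mul_assoc, hA (r τ) hτ (r τ') hτ']

/-! ### §2 The Helly number of `Hg(∏ A_i) = ∏ Hg(A_i)` is at most the index of an abelian subgroup of `Gal(L/ℚ)` -/

/-- **THE HELLY NUMBER IS AT MOST THE INDEX OF AN ABELIAN SUBGROUP OF `Gal(L/ℚ)`.**  CM fields `K_i ⊆ L` (`L` Galois
over `ℚ`), CM types `Φ_i`, and a subgroup `A ≤ Gal(L/ℚ)` with pairwise commuting elements: the family is
nondegenerate — `Hg(∏_i A_i) = ∏_i Hg(A_i)` of maximal rank — IFF every non-empty sub-family of AT MOST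
`[Gal(L/ℚ) : A] + 1` MEMBERS is nondegenerate.  No representation, certificate or character is listed.
[cite: Serre1977, §3.1 Cor. to Thm. 9 and §12.2] [cite: Mai1989, §2 Prop. 1 (proof)] [cite: Gordon1999HodgeAVSurvey, 7.5–7.7]
[cite: Shimura1998, §8.1] -/
theorem isNondegenerateFamily_iff_forall_card_le_index_succ [Nonempty I] (ι : L →+* ℂ) (e : ∀ i, K i →+* L)
    (Φ : ∀ i, CMType (K i)) (A : Subgroup (L ≃ₐ[ℚ] L)) (hA : ∀ a ∈ A, ∀ b ∈ A, a * b = b * a) :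
    CMAlgebra.IsNondegenerateFamily Φ ↔
      ∀ T : Finset I, T.Nonempty → T.card ≤ A.index + 1 →
        CMAlgebra.IsNondegenerateFamily (K := fun j : (T : Set I) => K j) fun j => Φ j := by
  classical
  obtain ⟨r, hr, hsurj⟩ := exists_restrictHom ι
  haveI : ∀ i, Nonempty (K i →+* ℂ) := fun i => inferInstance
  -- the preimage of `A` in `Aut(ℂ)`
  have hindex : (A.comap r).index = A.index := A.index_comap_of_surjective hsurj
  haveI : (A.comap r).FiniteIndex := ⟨by rw [hindex]; exact Subgroup.FiniteIndex.index_ne_zero⟩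
  have hmain := IrrOdd.typeRank_sigmaType_eq_iff_forall_card_le_index_succ_of_smul_comm (E := fun i => K i →+* ℂ)
    (fun i => isCMTypeWith_conj (Φ i)) (A.comap r) (smul_comm_of_comap_restrictHom ι e hr A hA)
  -- both sides through the ranks of the `Aut(ℂ)`-types
  have hcardI : Fintype.card (Σ i, (K i →+* ℂ)) = ∑ i, Module.finrank ℚ (K i) := by
    rw [Fintype.card_sigma]
    exact Finset.sum_congr rfl fun i _ => Embeddings.card (K i) ℂ
  have hcardT : ∀ T : Finset I, Fintype.card (Σ j : (T : Set I), (K j →+* ℂ)) =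
      ∑ j : (T : Set I), Module.finrank ℚ (K j) := by
    intro T
    rw [Fintype.card_sigma]
    exact Finset.sum_congr rfl fun j _ => Embeddings.card (K j) ℂ
  rw [CMAlgebra.isNondegenerateFamily_iff, ← hcardI]
  change typeRank (ℂ ≃+* ℂ) (sigmaType fun i => (Φ i).1) = _ ↔ _
  rw [hmain, hindex]
  refine forall_congr' fun T => forall_congr' fun hT => forall_congr' fun _ => ?_
  rw [CMAlgebra.isNondegenerateFamily_iff, ← hcardT T]
  rfl

/-- **A degenerate family has a degenerate sub-family of at most `[Gal(L/ℚ) : A] + 1` members** (`A ≤ Gal(L/ℚ)` with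
pairwise commuting elements): the failure of `Hg(∏_i A_i) = ∏_i Hg(A_i)` (at maximal rank) is witnessed on a product
of at most `[Gal(L/ℚ) : A] + 1` of the factors. [cite: Serre1977, §3.1 Cor. to Thm. 9] [cite: Gordon1999HodgeAVSurvey, 7.5–7.7] -/
theorem exists_card_le_index_succ_not_isNondegenerateFamily [Nonempty I] (ι : L →+* ℂ) (e : ∀ i, K i →+* L)
    (Φ : ∀ i, CMType (K i)) (A : Subgroup (L ≃ₐ[ℚ] L)) (hA : ∀ a ∈ A, ∀ b ∈ A, a * b = b * a)
    (hdeg : ¬ CMAlgebra.IsNondegenerateFamily Φ) :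
    ∃ T : Finset I, T.Nonempty ∧ T.card ≤ A.index + 1 ∧
      ¬ CMAlgebra.IsNondegenerateFamily (K := fun j : (T : Set I) => K j) fun j => Φ j := by
  by_contra hall
  push Not at hall
  exact hdeg ((isNondegenerateFamily_iff_forall_card_le_index_succ ι e Φ A hA).2 fun T hT hTc => hall T hT hTc)

/-- **Any single Galois element bounds the Helly number**: for every `g ∈ Gal(L/ℚ)`, the family is nondegenerate iff
every non-empty sub-family of at most `[Gal(L/ℚ) : ⟨g⟩] + 1` members is (`⟨g⟩` is abelian).  An element of order
`|Gal(L/ℚ)|/2` gives: TRIPLES decide. [cite: Serre1977, §3.1 Cor. to Thm. 9] [cite: Gordon1999HodgeAVSurvey, 7.5–7.7] -/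
theorem isNondegenerateFamily_iff_forall_card_le_index_zpowers_succ [Nonempty I] (ι : L →+* ℂ) (e : ∀ i, K i →+* L)
    (Φ : ∀ i, CMType (K i)) (g : L ≃ₐ[ℚ] L) :
    CMAlgebra.IsNondegenerateFamily Φ ↔
      ∀ T : Finset I, T.Nonempty → T.card ≤ (Subgroup.zpowers g).index + 1 →
        CMAlgebra.IsNondegenerateFamily (K := fun j : (T : Set I) => K j) fun j => Φ j :=
  isNondegenerateFamily_iff_forall_card_le_index_succ ι e Φ (Subgroup.zpowers g) fun a ha b hb => by
    obtain ⟨m, rfl⟩ := Subgroup.mem_zpowers_iff.1 ha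
    obtain ⟨n, rfl⟩ := Subgroup.mem_zpowers_iff.1 hb
    rw [← zpow_add, ← zpow_add, add_comm]

/-- **`Gal(L/ℚ)` abelian: PAIRS DECIDE** for arbitrary CM subfields `K_i ⊆ L` — `Hg(∏_i A_i) = ∏_i Hg(A_i)` of maximal
rank iff this holds for every pair (and every member is nondegenerate); the tree's abelian criterion recovered with no
character listed. [cite: Gordon1999HodgeAVSurvey, 7.5–7.7] [cite: Kubota1965, §4 Lemma 2] -/
theorem isNondegenerateFamily_iff_forall_card_le_two_of_comm [Nonempty I] (ι : L →+* ℂ) (e : ∀ i, K i →+* L)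
    (Φ : ∀ i, CMType (K i)) (hG : ∀ a b : L ≃ₐ[ℚ] L, a * b = b * a) :
    CMAlgebra.IsNondegenerateFamily Φ ↔
      ∀ T : Finset I, T.Nonempty → T.card ≤ 2 →
        CMAlgebra.IsNondegenerateFamily (K := fun j : (T : Set I) => K j) fun j => Φ j := by
  have h := isNondegenerateFamily_iff_forall_card_le_index_succ ι e Φ ⊤ fun a _ b _ => hG a b
  rwa [Subgroup.index_top] at h

/-! ### §3 The Hodge conjecture on all products from `([Gal(L/ℚ) : A] + 1)`-wise nondegeneracy -/

variable {A : I → AbelianVariety ℂ} {ιA : ∀ i, 𝓞 (K i) →+* End (A i)}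
  {θ : ∀ i, K i →+* Module.End ℂ (complexBetti (A i).X 1)}

/-- **HC ON ALL PRODUCTS FROM `(t+1)`-WISE NONDEGENERACY, `t` THE INDEX OF AN ABELIAN SUBGROUP OF `Gal(L/ℚ)`**: if every
non-empty sub-family of at most `[Gal(L/ℚ) : A] + 1` of the CM types `Φ_i` is nondegenerate (`A ≤ Gal(L/ℚ)` with
pairwise commuting elements), then on every product `⨁_{j<N} A_{c j}` of realisations the Hodge conjecture holds with
`B• = D•`. [cite: Gordon1999HodgeAVSurvey, 7.5 and 10.10] [cite: Serre1977, §3.1 Cor. to Thm. 9] -/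
theorem hodgeConjectureFor_prod_of_forall_card_le_index_succ [Nonempty I] (ι : L →+* ℂ) (e : ∀ i, K i →+* L)
    (Φ : ∀ i, CMType (K i)) (A' : Subgroup (L ≃ₐ[ℚ] L)) (hA' : ∀ a ∈ A', ∀ b ∈ A', a * b = b * a)
    (hsub : ∀ T : Finset I, T.Nonempty → T.card ≤ A'.index + 1 →
      CMAlgebra.IsNondegenerateFamily (K := fun j : (T : Set I) => K j) fun j => Φ j)
    (hA : ∀ i, IsCMTypeRealisation (Φ i) (A i) (ιA i) (θ i)) {N : ℕ} (c : Fin N → I) :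
    HodgeConjectureFor (⨁ fun j : Fin N => A (c j)).dim (⨁ fun j : Fin N => A (c j)).X ∧
      ∀ m : ℕ, hodgeClassSpan (⨁ fun j : Fin N => A (c j)).dim (⨁ fun j : Fin N => A (c j)).X m =
        divisorClassesSpan (⨁ fun j : Fin N => A (c j)).X (⨁ fun j : Fin N => A (c j)).dim m := by
  have hnd : CMAlgebra.IsNondegenerateFamily Φ :=
    (isNondegenerateFamily_iff_forall_card_le_index_succ ι e Φ A' hA').2 hsub
  exact ⟨hnd.hodgeConjectureFor_prod hA c, fun m => hnd.hodgeClassSpan_prod_eq_divisorClassesSpan hA c m⟩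

/-- **TRIPLES from an abelian subgroup of index two** (dihedral, quaternion, dicyclic, semidihedral, … Galois groups):
if `A ≤ Gal(L/ℚ)` has pairwise commuting elements and index `≤ 2`, and every sub-family of at most THREE of the `Φ_i`
is nondegenerate, then HC holds with `B• = D•` on every product of realisations.
[cite: Gordon1999HodgeAVSurvey, 7.5 and 10.10] [cite: Serre1977, §3.1 Cor. to Thm. 9] -/
theorem hodgeConjectureFor_prod_of_forall_card_le_three [Nonempty I] (ι : L →+* ℂ) (e : ∀ i, K i →+* L)
    (Φ : ∀ i, CMType (K i)) (A' : Subgroup (L ≃ₐ[ℚ] L)) (hA' : ∀ a ∈ A', ∀ b ∈ A', a * b = b * a)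
    (hindex : A'.index ≤ 2)
    (hsub : ∀ T : Finset I, T.Nonempty → T.card ≤ 3 →
      CMAlgebra.IsNondegenerateFamily (K := fun j : (T : Set I) => K j) fun j => Φ j)
    (hA : ∀ i, IsCMTypeRealisation (Φ i) (A i) (ιA i) (θ i)) {N : ℕ} (c : Fin N → I) :
    HodgeConjectureFor (⨁ fun j : Fin N => A (c j)).dim (⨁ fun j : Fin N => A (c j)).X ∧
      ∀ m : ℕ, hodgeClassSpan (⨁ fun j : Fin N => A (c j)).dim (⨁ fun j : Fin N => A (c j)).X m =
        divisorClassesSpan (⨁ fun j : Fin N => A (c j)).X (⨁ fun j : Fin N => A (c j)).dim m :=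
  hodgeConjectureFor_prod_of_forall_card_le_index_succ ι e Φ A' hA'
    (fun T hT hTc => hsub T hT (hTc.trans (by omega))) hA c

end Summit.HodgeConjecture.CorCM

end
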